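import Summits.CriticalPhenomena.Ising3DConformalLimit.Theorems.PrecisionLaplacianDirectCorrelationStableTailPickInversionAux16
import Summits.CriticalPhenomena.Ising3DConformalLimit.Theorems.PrecisionLaplacianDirectCorrelationStableTailPickInversionAux17

/-!
# Diagonal line holomorphy, auxiliary file 3: Green quadratic forms as slab integrals, the sheared
# step law, and the diagonal line transforms

Helper file for the sub-stub `stub_slabModeExpDecay_auxDiagLineHol` (brick of `stub_slabModeExpDecay`)
of line `self-energy-pick-inversion`, crux `PrecisionLaplacian.DirectCorrelationStableTail`
(stmt-CriticalPhenomena-4799). Pure theorem file.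

For an even sub-stochastic step law `q` on `ℤ³` with symbol `φ(ξ) = ∑ q(x) cos(ξ·x)`, Green symbol
function `g = (1 - φ)⁻¹` and Green function `G = ∑ⱼ q^{∗j}`:

* `green_form_eq_slab_integral` : for every finite `S ⊂ ℤ³`, weights `V`, shift `u` and direction `i`,
  `(2π)³ ∑_{z,z'∈S} V_z V_{z'} G(z - z' + u) = ∫_{[-π,π]²} ∫_{-π}^{π} cos(ξ·u) g(ξ) W_V(ξ)|_{ξ = ins_i(θ,k)} dθ dk`
  (files `…PickInversionAux11–12`: weighted Parseval and Fubini along the `i`-th coordinate);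
* the **shear** `σ(y) = (y₀ + y₁, -y₁, y₂)` (an involution of `ℤ³` mapping the coordinate plane
  `{y₀ = 0}` onto the diagonal plane `{x₀ + x₁ = 0}`, `σ(0, a₀, a₁) = (a₀, -a₀, a₁)`, and the axis `e₀`
  to `e₀`): `q ∘ σ` is again an even sub-stochastic step law with convolution powers `P j ∘ σ` and
  Green function `G ∘ σ` (`shear_stepLaw`), and its symbol at `ins₀(θ, k)` is `φ(θ, θ - k₀, k₁)`
  (`symbol_shear`): the axis-`0` slab circles of the sheared law are the diagonal lines
  `θ ↦ p_k + θ(e₀ + e₁)`, `p_k = (k₀/2, -k₀/2, k₁)`, of the original one, up to the shift `θ ↦ θ - k₀/2`;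
* the **diagonal line function** `γ_k(θ) = g(θ + k₀/2, θ - k₀/2, k₁)` and its cosine transforms
  `c_m(k) = ∫_{-π}^{π} cos(mθ) γ_k(θ) dθ`: `2π`-periodicity, evenness in `θ` and in `k` (for `q`
  invariant under `x ↦ (x₁, x₀, -x₂)`), positivity and continuity off the reciprocal lattice,
  measurability, `|c_m| ≤ c₀`, and integrability of `c₀` over the transverse Brillouin zone.
-/

noncomputable section

namespace Summit.CriticalPhenomena.Ising3DConformalLimit.Cruxes.DirectCorrelationStableTail.SelfEnergyPickInversion

open MeasureTheory Filter Topology Finset Real Literature.Probability.LatticeModels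
open scoped BigOperators
open Summit.CriticalPhenomena.Ising3DConformalLimit.Theorems.EtaBoundsTransfer
  (continuous_phase continuous_fourier_q abs_fourier_q_le_one integrableOn_cube_of_continuous
    volume_cube_lt_top)

variable {q : Site 3 → ℝ} {P : ℕ → Site 3 → ℝ}

/-! ### Green quadratic forms as slab integrals -/

/-- **Green quadratic forms as slab integrals.** For the Green function `G = ∑ⱼ q^{∗j}` of an even
sub-stochastic step law `q` on `ℤ³`, a direction `i`, a finite `S ⊂ ℤ³`, weights `V` and a shift `u`:
the slice integrals `k ↦ ∫_{-π}^{π} cos(ξ·u) (1 - φ(ξ))⁻¹ W_V(ξ) dθ` (`ξ = ins_i(θ, k)`,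
`W_V(ξ) = ∑_{z,z'∈S} V_z V_{z'} cos(ξ·(z - z'))`) are integrable over `[-π,π]²` and integrate to
`(2π)³ ∑_{z,z'∈S} V_z V_{z'} G(z - z' + u)`. [folklore] -/
theorem green_form_eq_slab_integral (hq0 : ∀ y, 0 ≤ q y) (hqs : Summable q) (hq1 : ∑' y, q y ≤ 1)
    (hqev : ∀ y, q (-y) = q y) (hP0 : ∀ z, P 0 z = if z = 0 then 1 else 0)
    (hPs : ∀ j z, P (j + 1) z = ∑' y, q y * P j (z - y))
    {G : Site 3 → ℝ} (hGreen : ∀ z, HasSum (fun j => P j z) (G z))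
    (i : Fin 3) (S : Finset (Site 3)) (V : Site 3 → ℝ) (u : Site 3) :
    IntegrableOn (fun k : Fin 2 → ℝ => ∫ θ in (-π)..π,
        Real.cos (phase 3 (Fin.insertNth i θ k : Fin 3 → ℝ) u) *
          (1 - ∑' x : Site 3, q x * Real.cos (phase 3 (Fin.insertNth i θ k : Fin 3 → ℝ) x))⁻¹ *
          ∑ z ∈ S, ∑ z' ∈ S, V z * V z' * Real.cos (phase 3 (Fin.insertNth i θ k : Fin 3 → ℝ) (z - z')))
      (Set.pi Set.univ (fun _ : Fin 2 => Set.Icc (-π) π)) volume ∧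
    (2 * π) ^ 3 * ∑ z ∈ S, ∑ z' ∈ S, V z * V z' * G (z - z' + u) =
      ∫ k in Set.pi Set.univ (fun _ : Fin 2 => Set.Icc (-π) π), ∫ θ in (-π)..π,
        Real.cos (phase 3 (Fin.insertNth i θ k : Fin 3 → ℝ) u) *
          (1 - ∑' x : Site 3, q x * Real.cos (phase 3 (Fin.insertNth i θ k : Fin 3 → ℝ) x))⁻¹ *
          ∑ z ∈ S, ∑ z' ∈ S, V z * V z' * Real.cos (phase 3 (Fin.insertNth i θ k : Fin 3 → ℝ) (z - z')) := by
  -- adapted from `slab_form_eq_integral` (file `…PickInversionAux16`)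
  have hπ := Real.pi_pos
  set φ : (Fin 3 → ℝ) → ℝ := fun ξ => ∑' x : Site 3, q x * Real.cos (phase 3 ξ x) with hφ
  obtain ⟨hint, -⟩ := integrableOn_inv_one_sub_symbol hq0 hqs hq1 hqev hP0 hPs (hGreen 0)
  set K3 := Set.pi Set.univ (fun _ : Fin 3 => Set.Icc (-π) π) with hK3
  set W : (Fin 3 → ℝ) → ℝ := fun ξ => ∑ z ∈ S, ∑ z' ∈ S, V z * V z' * Real.cos (phase 3 ξ (z - z')) with hW
  have hWcont : Continuous W := by
    refine continuous_finsetSum _ fun x _ => continuous_finsetSum _ fun y _ => ?_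
    have := continuous_phase (d := 3) (x - y); fun_prop
  obtain ⟨B, hB⟩ : ∃ B, ∀ ξ, |W ξ| ≤ B := ⟨∑ x ∈ S, ∑ y ∈ S, |V x| * |V y|, fun ξ => by
    calc |∑ x ∈ S, ∑ y ∈ S, V x * V y * Real.cos (phase 3 ξ (x - y))|
        ≤ ∑ x ∈ S, |∑ y ∈ S, V x * V y * Real.cos (phase 3 ξ (x - y))| := Finset.abs_sum_le_sum_abs _ _
      _ ≤ ∑ x ∈ S, ∑ y ∈ S, |V x * V y * Real.cos (phase 3 ξ (x - y))| :=
          Finset.sum_le_sum fun x _ => Finset.abs_sum_le_sum_abs _ _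
      _ ≤ ∑ x ∈ S, ∑ y ∈ S, |V x| * |V y| :=
          Finset.sum_le_sum fun x _ => Finset.sum_le_sum fun y _ => by
            rw [abs_mul, abs_mul]
            exact mul_le_of_le_one_right (by positivity) (Real.abs_cos_le_one _)⟩
  set F : (Fin 3 → ℝ) → ℝ := fun ξ => Real.cos (phase 3 ξ u) * (1 - φ ξ)⁻¹ * W ξ with hF
  have hFint : IntegrableOn F K3 volume := by
    have h1 : IntegrableOn (fun ξ => (1 - φ ξ)⁻¹ * W ξ) K3 volume :=
      hint.mul_bdd (c := B) hWcont.aestronglyMeasurable (ae_of_all _ fun ξ => by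
        rw [Real.norm_eq_abs]; exact hB ξ)
    have hcos : Continuous fun ξ : Fin 3 → ℝ => Real.cos (phase 3 ξ u) :=
      Real.continuous_cos.comp (continuous_phase u)
    refine (h1.bdd_mul (c := 1) hcos.aestronglyMeasurable
      (ae_of_all _ fun ξ => by rw [Real.norm_eq_abs]; exact Real.abs_cos_le_one _)).congr ?_
    exact ae_of_all _ fun ξ => by simp only [hF]; ring
  obtain ⟨hint0, hslab⟩ := setIntegral_cube_eq_slab i hFint
  have hslice : ∀ k : Fin 2 → ℝ, ∫ θ in Set.Icc (-π) π, F (Fin.insertNth i θ k) =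
      ∫ θ in (-π)..π, F (Fin.insertNth i θ k) := by
    intro k
    rw [integral_Icc_eq_integral_Ioc, ← intervalIntegral.integral_of_le (by linarith)]
  simp_rw [hslice] at hint0 hslab
  refine ⟨hint0, ?_⟩
  rw [green_form_eq_integral hq0 hqs hq1 hqev hP0 hPs hGreen S V u]
  exact hslab

/-! ### The shear -/

/-- The shear `σ(y) = (y₀ + y₁, -y₁, y₂)` is an involution of `ℤ³`. [folklore] -/
theorem shear_involutive : Function.Involutive (fun y : Site 3 => (![y 0 + y 1, -(y 1), y 2] : Site 3)) := by
  intro y; ext j; fin_cases j <;> simp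

/-- The shear is additive. [folklore] -/
theorem shear_add (y y' : Site 3) :
    (![(y + y') 0 + (y + y') 1, -((y + y') 1), (y + y') 2] : Site 3) =
      ![y 0 + y 1, -(y 1), y 2] + ![y' 0 + y' 1, -(y' 1), y' 2] := by
  ext j; fin_cases j <;> simp <;> ring

/-- The shear commutes with negation. [folklore] -/
theorem shear_neg (y : Site 3) :
    (![(-y) 0 + (-y) 1, -((-y) 1), (-y) 2] : Site 3) = -![y 0 + y 1, -(y 1), y 2] := by
  ext j; fin_cases j <;> simp
  ring

/-- The shear maps only `0` to `0`. [folklore] -/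
theorem shear_eq_zero_iff (y : Site 3) : (![y 0 + y 1, -(y 1), y 2] : Site 3) = 0 ↔ y = 0 := by
  constructor
  · intro h
    have h0 := congrFun h 0; have h1 := congrFun h 1; have h2 := congrFun h 2
    simp at h0 h1 h2
    ext j; fin_cases j <;> simp <;> omega
  · rintro rfl; ext j; fin_cases j <;> simp

/-- **The sheared step law.** `q ∘ σ` is a nonnegative even summable step law with the same mass,
convolution powers `P j ∘ σ` and Green function `G ∘ σ`. [folklore] -/
theorem shear_stepLaw (hq0 : ∀ y, 0 ≤ q y) (hqs : Summable q) (hq1 : ∑' y, q y ≤ 1)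
    (hqev : ∀ y, q (-y) = q y) (hP0 : ∀ z, P 0 z = if z = 0 then 1 else 0)
    (hPs : ∀ j z, P (j + 1) z = ∑' y, q y * P j (z - y))
    {G : Site 3 → ℝ} (hGreen : ∀ z, HasSum (fun j => P j z) (G z)) :
    (∀ y : Site 3, 0 ≤ q ![y 0 + y 1, -(y 1), y 2]) ∧ (Summable fun y : Site 3 => q ![y 0 + y 1, -(y 1), y 2]) ∧
    (∑' y : Site 3, q ![y 0 + y 1, -(y 1), y 2] ≤ 1) ∧
    (∀ y : Site 3, q ![(-y) 0 + (-y) 1, -((-y) 1), (-y) 2] = q ![y 0 + y 1, -(y 1), y 2]) ∧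
    (∀ z : Site 3, P 0 ![z 0 + z 1, -(z 1), z 2] = if z = 0 then 1 else 0) ∧
    (∀ (j : ℕ) (z : Site 3), P (j + 1) ![z 0 + z 1, -(z 1), z 2] =
      ∑' y : Site 3, q ![y 0 + y 1, -(y 1), y 2] * P j ![(z - y) 0 + (z - y) 1, -((z - y) 1), (z - y) 2]) ∧
    (∀ z : Site 3, HasSum (fun j => P j ![z 0 + z 1, -(z 1), z 2]) (G ![z 0 + z 1, -(z 1), z 2])) := by
  set σ : Site 3 ≃ Site 3 := Function.Involutive.toPerm _ shear_involutive with hσ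
  have hσapp : ∀ y : Site 3, σ y = ![y 0 + y 1, -(y 1), y 2] := fun y => rfl
  have hsum : Summable fun y : Site 3 => q ![y 0 + y 1, -(y 1), y 2] := (σ.summable_iff (f := q)).2 hqs
  have htsum : ∑' y : Site 3, q ![y 0 + y 1, -(y 1), y 2] = ∑' y, q y := σ.tsum_eq q
  refine ⟨fun y => hq0 _, hsum, htsum ▸ hq1, fun y => by rw [shear_neg, hqev], fun z => ?_, fun j z => ?_,
    fun z => hGreen _⟩
  · rw [hP0]; exact if_congr (shear_eq_zero_iff z) rfl rfl
  · rw [hPs, ← σ.tsum_eq (fun y => q y * P j (![z 0 + z 1, -(z 1), z 2] - y))]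
    refine tsum_congr fun y => ?_
    rw [hσapp]
    congr 2
    have := shear_add (z - y) y
    rw [sub_add_cancel] at this
    rw [this, add_sub_cancel_right]

/-- `ins₀(θ, k) = (θ, k₀, k₁)`. [folklore] -/
theorem insertNth_zero_eq_vec3 (θ : ℝ) (k : Fin 2 → ℝ) : (Fin.insertNth 0 θ k : Fin 3 → ℝ) = ![θ, k 0, k 1] := by
  ext j; fin_cases j <;> rfl

/-- `(θ, k₀, k₁)·y` and `(θ, θ - k₀, k₁)·x` expanded. [folklore] -/
theorem phase_vec3 (a b c : ℝ) (x : Site 3) : phase 3 ![a, b, c] x = a * x 0 + b * x 1 + c * x 2 := by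
  simp [phase, Fin.sum_univ_three]

/-- **The symbol under the shear**: `∑ q(σy) cos(ξ·y) = φ(σᵀξ)`, `σᵀ(ξ₀, ξ₁, ξ₂) = (ξ₀, ξ₀ - ξ₁, ξ₂)`;
at `ξ = ins₀(θ, k)` this is `φ(θ, θ - k₀, k₁)`. [folklore] -/
theorem symbol_shear (q : Site 3 → ℝ) (θ : ℝ) (k : Fin 2 → ℝ) :
    ∑' y : Site 3, q ![y 0 + y 1, -(y 1), y 2] * Real.cos (phase 3 (Fin.insertNth 0 θ k : Fin 3 → ℝ) y) =
      ∑' x : Site 3, q x * Real.cos (phase 3 ![θ, θ - k 0, k 1] x) := by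
  set σ : Site 3 ≃ Site 3 := Function.Involutive.toPerm _ shear_involutive with hσ
  have hσapp : ∀ y : Site 3, σ y = ![y 0 + y 1, -(y 1), y 2] := fun y => rfl
  rw [← σ.tsum_eq (fun x : Site 3 => q x * Real.cos (phase 3 ![θ, θ - k 0, k 1] x))]
  refine tsum_congr fun y => ?_
  rw [hσapp, insertNth_zero_eq_vec3, phase_vec3, phase_vec3]
  congr 2
  simp only [Matrix.cons_val_zero, Matrix.cons_val_one, Matrix.cons_val]
  push_cast
  ring

/-! ### The diagonal line function `γ_k(θ) = g(θ + k₀/2, θ - k₀/2, k₁)` -/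

/-- A positive margin from non-membership in `2πℤ`. [folklore] -/
theorem exists_margin_of_forall_ne {a : ℝ} (ha : ∀ z : ℤ, a ≠ z * (2 * π)) :
    ∃ m₀ : ℝ, 0 < m₀ ∧ ∀ z : ℤ, m₀ ≤ |a - z * (2 * π)| := by
  have h2π := Real.two_pi_pos
  set x : ℝ := a / (2 * π) with hx
  have hax : a = x * (2 * π) := by rw [hx]; field_simp
  have hne : x - round x ≠ 0 := by
    intro h
    apply ha (round x)
    rw [hax, show x = round x by linarith, round_intCast]
  refine ⟨|x - round x| * (2 * π), by positivity, fun z => ?_⟩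
  rw [hax, ← sub_mul, abs_mul, abs_of_pos h2π]
  refine mul_le_mul_of_nonneg_right ?_ h2π.le
  by_cases hz : z = round x
  · rw [hz]
  · have h1 : |x - round x| ≤ 1 / 2 := abs_sub_round x
    have h2 : (1 : ℝ) ≤ |(z : ℝ) - round x| := by
      rw [← Int.cast_sub, ← Int.cast_abs]
      exact_mod_cast Int.one_le_abs (sub_ne_zero.2 hz)
    have h3 := abs_sub_abs_le_abs_sub ((z : ℝ) - round x) (x - round x)
    rw [show (z : ℝ) - round x - (x - round x) = -(x - z) by ring, abs_neg] at h3
    linarith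

/-- **The diagonal line function is `2π`-periodic in the angle.** [folklore] -/
theorem lineFun_periodic (q : Site 3 → ℝ) (k : Fin 2 → ℝ) :
    Function.Periodic (fun θ : ℝ => (1 - ∑' x : Site 3,
      q x * Real.cos (phase 3 ![θ + k 0 / 2, θ - k 0 / 2, k 1] x))⁻¹) (2 * π) := by
  intro θ
  simp only
  congr 2
  refine tsum_congr fun x => ?_
  congr 1
  rw [phase_vec3, phase_vec3, show (θ + 2 * π + k 0 / 2) * x 0 + (θ + 2 * π - k 0 / 2) * x 1 + k 1 * x 2 =
    ((θ + k 0 / 2) * x 0 + (θ - k 0 / 2) * x 1 + k 1 * x 2) + ((x 0 + x 1 : ℤ) : ℝ) * (2 * π) by push_cast; ring,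
    Real.cos_add_int_mul_two_pi]

/-- **Evenness in the angle**, for `q` even and invariant under `x ↦ (x₁, x₀, -x₂)`: the symmetry
`x ↦ (-x₁, -x₀, x₂)` fixes the base point `(k₀/2, -k₀/2, k₁)` and reverses `e₀ + e₁`. [folklore] -/
theorem lineFun_neg (hqev : ∀ y, q (-y) = q y) (hqsym : ∀ x : Site 3, q ![x 1, x 0, -(x 2)] = q x)
    (k : Fin 2 → ℝ) (θ : ℝ) :
    (1 - ∑' x : Site 3, q x * Real.cos (phase 3 ![-θ + k 0 / 2, -θ - k 0 / 2, k 1] x))⁻¹ =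
      (1 - ∑' x : Site 3, q x * Real.cos (phase 3 ![θ + k 0 / 2, θ - k 0 / 2, k 1] x))⁻¹ := by
  have hinv : Function.Involutive (fun x : Site 3 => (![-(x 1), -(x 0), x 2] : Site 3)) := by
    intro x; ext j; fin_cases j <;> simp
  set τ : Site 3 ≃ Site 3 := hinv.toPerm _ with hτ
  congr 2
  rw [← τ.tsum_eq (fun x : Site 3 => q x * Real.cos (phase 3 ![θ + k 0 / 2, θ - k 0 / 2, k 1] x))]
  refine tsum_congr fun x => ?_
  have hτx : τ x = ![-(x 1), -(x 0), x 2] := rfl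
  have hq : q (![-(x 1), -(x 0), x 2]) = q x := by
    rw [← hqev, ← hqsym x]
    congr 1; ext j; fin_cases j <;> simp
  rw [hτx, hq, phase_vec3, phase_vec3]
  congr 2
  simp only [Matrix.cons_val_zero, Matrix.cons_val_one, Matrix.cons_val]
  push_cast; ring

/-- **Evenness in the transverse momentum**, for `q` invariant under `x ↦ (x₁, x₀, -x₂)`. [folklore] -/
theorem lineFun_neg_momentum (hqsym : ∀ x : Site 3, q ![x 1, x 0, -(x 2)] = q x) (k : Fin 2 → ℝ) (θ : ℝ) :
    (1 - ∑' x : Site 3, q x * Real.cos (phase 3 ![θ + (-k) 0 / 2, θ - (-k) 0 / 2, (-k) 1] x))⁻¹ =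
      (1 - ∑' x : Site 3, q x * Real.cos (phase 3 ![θ + k 0 / 2, θ - k 0 / 2, k 1] x))⁻¹ := by
  have hinv : Function.Involutive (fun x : Site 3 => (![x 1, x 0, -(x 2)] : Site 3)) := by
    intro x; ext j; fin_cases j <;> simp
  set τ : Site 3 ≃ Site 3 := hinv.toPerm _ with hτ
  congr 2
  rw [← τ.tsum_eq (fun x : Site 3 => q x * Real.cos (phase 3 ![θ + k 0 / 2, θ - k 0 / 2, k 1] x))]
  refine tsum_congr fun x => ?_
  have hτx : τ x = ![x 1, x 0, -(x 2)] := rfl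
  rw [hτx, hqsym, phase_vec3, phase_vec3]
  congr 2
  simp only [Matrix.cons_val_zero, Matrix.cons_val_one, Matrix.cons_val, Pi.neg_apply]
  push_cast; ring

/-- **Off the reciprocal lattice the line is good**: if `k ∉ (2πℤ)²` then every point
`(θ + k₀/2, θ - k₀/2, k₁)` has a coordinate outside `2πℤ`. [folklore] -/
theorem exists_coord_not_mem_of_line {k : Fin 2 → ℝ} (hk : ∃ j, ∀ z : ℤ, k j ≠ z * (2 * π)) (θ : ℝ) :
    ∃ m : Fin 3, ∀ z : ℤ, (![θ + k 0 / 2, θ - k 0 / 2, k 1] : Fin 3 → ℝ) m ≠ z * (2 * π) := by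
  by_contra hcon
  push Not at hcon
  obtain ⟨z0, hz0⟩ := hcon 0
  obtain ⟨z1, hz1⟩ := hcon 1
  obtain ⟨z2, hz2⟩ := hcon 2
  simp only [Matrix.cons_val_zero, Matrix.cons_val_one, Matrix.cons_val] at hz0 hz1 hz2
  obtain ⟨j, hj⟩ := hk
  fin_cases j
  · exact hj (z0 - z1) (by push_cast; linarith)
  · exact hj z2 hz2

/-- **Positivity and continuity of the line function at a good momentum.** If the Green function is
positive at the unit vectors and `k ∉ (2πℤ)²`, then `1 - φ > 0` along the line and `γ_k` is
continuous. [folklore] -/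
theorem lineFun_pos_continuous (hq0 : ∀ y, 0 ≤ q y) (hqs : Summable q) (hq1 : ∑' y, q y ≤ 1)
    (hP0 : ∀ z, P 0 z = if z = 0 then 1 else 0) (hPs : ∀ j z, P (j + 1) z = ∑' y, q y * P j (z - y))
    {G : Site 3 → ℝ} (hGreen : ∀ z, HasSum (fun j => P j z) (G z)) (hGpos : ∀ m : Fin 3, 0 < G (Pi.single m 1))
    {k : Fin 2 → ℝ} (hk : ∃ j, ∀ z : ℤ, k j ≠ z * (2 * π)) :
    (∀ θ : ℝ, 0 < 1 - ∑' x : Site 3, q x * Real.cos (phase 3 ![θ + k 0 / 2, θ - k 0 / 2, k 1] x)) ∧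
    Continuous (fun θ : ℝ => (1 - ∑' x : Site 3,
      q x * Real.cos (phase 3 ![θ + k 0 / 2, θ - k 0 / 2, k 1] x))⁻¹) := by
  have hpos : ∀ θ : ℝ, 0 < 1 - ∑' x : Site 3, q x * Real.cos (phase 3 ![θ + k 0 / 2, θ - k 0 / 2, k 1] x) :=
    fun θ => sub_pos.2 (symbol_lt_one_of_not_mem_lattice hq0 hqs hq1 hP0 hPs hGreen hGpos
      (exists_coord_not_mem_of_line hk θ))
  refine ⟨hpos, ?_⟩
  have hline : Continuous fun θ : ℝ => (![θ + k 0 / 2, θ - k 0 / 2, k 1] : Fin 3 → ℝ) := by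
    refine continuous_pi fun j => ?_
    fin_cases j <;> simp <;> fun_prop
  have hφ := continuous_fourier_q (d := 3) hqs
  exact ((continuous_const.sub (hφ.comp hline)).inv₀ fun θ => (hpos θ).ne')

/-! ### The cosine transforms `c_m(k) = ∫ cos(mθ) γ_k(θ) dθ` -/

/-- **Measurability of the line transforms** in the transverse momentum: for every bounded continuous
weight `w`, `k ↦ ∫_{-π}^{π} w(θ) γ_k(θ) dθ` is measurable on `ℝ²`. [folklore] -/
theorem measurable_lineTransform (hqs : Summable q) {w : ℝ → ℝ} (hw : Continuous w) :
    Measurable (fun k : Fin 2 → ℝ => ∫ θ in (-π)..π, w θ * (1 - ∑' x : Site 3,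
      q x * Real.cos (phase 3 ![θ + k 0 / 2, θ - k 0 / 2, k 1] x))⁻¹) := by
  have hline : Continuous fun p : (Fin 2 → ℝ) × ℝ => (![p.2 + p.1 0 / 2, p.2 - p.1 0 / 2, p.1 1] : Fin 3 → ℝ) := by
    refine continuous_pi fun j => ?_
    fin_cases j <;> simp <;> fun_prop
  have hφ := continuous_fourier_q (d := 3) hqs
  have hF : Measurable (Function.uncurry fun (k : Fin 2 → ℝ) (θ : ℝ) => w θ * (1 - ∑' x : Site 3,
      q x * Real.cos (phase 3 ![θ + k 0 / 2, θ - k 0 / 2, k 1] x))⁻¹) := by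
    refine Measurable.mul (hw.measurable.comp measurable_snd) ?_
    exact ((continuous_const.sub (hφ.comp hline)).measurable).inv
  simp_rw [intervalIntegral.integral_of_le (by linarith [Real.pi_pos] : -π ≤ π)]
  exact (hF.stronglyMeasurable.integral_prod_right' (ν := volume.restrict (Set.Ioc (-π) π))).measurable

/-- **Domination by the zeroth transform**: `|∫ w γ_k| ≤ ∫ γ_k` for `|w| ≤ 1`, at a good momentum.
[folklore] -/
theorem abs_lineTransform_le {γ : ℝ → ℝ} (hγ : Continuous γ) (hγ0 : ∀ θ, 0 ≤ γ θ) {w : ℝ → ℝ}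
    (hw : Continuous w) (hw1 : ∀ θ, |w θ| ≤ 1) :
    |∫ θ in (-π)..π, w θ * γ θ| ≤ ∫ θ in (-π)..π, γ θ := by
  have hπ := Real.pi_pos
  calc |∫ θ in (-π)..π, w θ * γ θ| ≤ ∫ θ in (-π)..π, |w θ * γ θ| :=
        intervalIntegral.abs_integral_le_integral_abs (by linarith)
    _ ≤ ∫ θ in (-π)..π, γ θ := by
        refine intervalIntegral.integral_mono_on (by linarith) ?_ (hγ.intervalIntegrable _ _) fun θ _ => ?_
        · exact ((hw.mul hγ).abs).intervalIntegrable _ _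
        · rw [abs_mul, abs_of_nonneg (hγ0 θ)]
          exact mul_le_of_le_one_left (hγ0 θ) (hw1 θ)

/-- **Continuity of the line transforms at a good momentum**: if `k₀ ∉ (2πℤ)²` then
`k ↦ ∫_{-π}^{π} cos(mθ) γ_k(θ) dθ` is continuous at `k₀` (file `…PickInversionAux12`,
`continuousAt_slab_transform`, for `Φ(ξ) = 1 - φ(ξ₀ + ξ₁/2, ξ₀ - ξ₁/2, ξ₂)`). [folklore] -/
theorem continuousAt_lineTransform (hq0 : ∀ y, 0 ≤ q y) (hqs : Summable q) (hq1 : ∑' y, q y ≤ 1)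
    (hP0 : ∀ z, P 0 z = if z = 0 then 1 else 0) (hPs : ∀ j z, P (j + 1) z = ∑' y, q y * P j (z - y))
    {G : Site 3 → ℝ} (hGreen : ∀ z, HasSum (fun j => P j z) (G z)) (hGpos : ∀ m : Fin 3, 0 < G (Pi.single m 1))
    {k₀ : Fin 2 → ℝ} (hk₀ : ∃ j, ∀ z : ℤ, k₀ j ≠ z * (2 * π)) (m : ℕ) :
    ContinuousAt (fun k : Fin 2 → ℝ => ∫ θ in (-π)..π, Real.cos (m * θ) * (1 - ∑' x : Site 3,
      q x * Real.cos (phase 3 ![θ + k 0 / 2, θ - k 0 / 2, k 1] x))⁻¹) k₀ := by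
  obtain ⟨j, hj⟩ := hk₀
  obtain ⟨m₀, hm₀, hmarg⟩ := exists_margin_of_forall_ne hj
  set Φ : (Fin 3 → ℝ) → ℝ := fun ξ => 1 - ∑' x : Site 3,
    q x * Real.cos (phase 3 ![ξ 0 + ξ 1 / 2, ξ 0 - ξ 1 / 2, ξ 2] x) with hΦ
  have hA : Continuous fun ξ : Fin 3 → ℝ => (![ξ 0 + ξ 1 / 2, ξ 0 - ξ 1 / 2, ξ 2] : Fin 3 → ℝ) := by
    refine continuous_pi fun j => ?_
    fin_cases j <;> simp <;> fun_prop
  have hΦc : Continuous Φ := continuous_const.sub ((continuous_fourier_q (d := 3) hqs).comp hA)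
  have hΦins : ∀ (θ : ℝ) (k : Fin 2 → ℝ), Φ (Fin.insertNth 0 θ k) =
      1 - ∑' x : Site 3, q x * Real.cos (phase 3 ![θ + k 0 / 2, θ - k 0 / 2, k 1] x) := by
    intro θ k; simp only [hΦ, insertNth_zero_eq_vec3, Matrix.cons_val_zero, Matrix.cons_val_one, Matrix.cons_val]
  -- goodness persists on the ball of radius `m₀/2` in the `j`-th coordinate
  have hgood : ∀ k ∈ Metric.closedBall k₀ (m₀ / 2), ∃ j', ∀ z : ℤ, k j' ≠ z * (2 * π) := by
    intro k hk
    refine ⟨j, fun z hz => ?_⟩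
    have hd : |k j - k₀ j| ≤ m₀ / 2 := by
      have := dist_le_pi_dist k k₀ j; rw [Real.dist_eq] at this; exact this.trans hk
    have := hmarg z
    rw [← hz, abs_sub_comm] at this
    linarith
  have hposball : ∀ k ∈ Metric.closedBall k₀ (m₀ / 2), ∀ θ ∈ Set.Icc (-π) π, 0 < Φ (Fin.insertNth 0 θ k) := by
    intro k hk θ _
    rw [hΦins]
    exact (lineFun_pos_continuous hq0 hqs hq1 hP0 hPs hGreen hGpos (hgood k hk)).1 θ
  have h := continuousAt_slab_transform 0 hΦc (by positivity) hposball m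
  simp only [hΦins, div_eq_mul_inv] at h
  exact h

/-- **Registered auxiliary stub `stub_slabModeExpDecay_auxDiagLineHol4`** (sub-goal of the brick
`stub_slabModeExpDecay_auxDiagLineHol` of `stub_slabModeExpDecay`): Green quadratic forms on `ℤ³` as
slab integrals of the Green symbol function (`green_form_eq_slab_integral`). [folklore] -/
theorem stub_slabModeExpDecay_auxDiagLineHol4 : ∀ (q : Site 3 → ℝ) (P : ℕ → Site 3 → ℝ) (G : Site 3 → ℝ), (∀ y, 0 ≤ q y) → Summable q → ∑' y, q y ≤ 1 → (∀ y, q (-y) = q y) → (∀ z, P 0 z = if z = 0 then 1 else 0) → (∀ j z, P (j + 1) z = ∑' y, q y * P j (z - y)) → (∀ z, HasSum (fun j => P j z) (G z)) → ∀ (i : Fin 3) (S : Finset (Site 3)) (V : Site 3 → ℝ) (u : Site 3), (2 * Real.pi) ^ 3 * ∑ z ∈ S, ∑ z' ∈ S, V z * V z' * G (z - z' + u) = ∫ k in Set.pi Set.univ (fun _ : Fin 2 => Set.Icc (-Real.pi) Real.pi), ∫ θ in (-Real.pi)..Real.pi, Real.cos (∑ j, (Fin.insertNth i θ k : Fin 3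 → ℝ) j * (u j : ℝ)) * (1 - ∑' x : Site 3, q x * Real.cos (∑ j, (Fin.insertNth i θ k : Fin 3 → ℝ) j * (x j : ℝ)))⁻¹ * ∑ z ∈ S, ∑ z' ∈ S, V z * V z' * Real.cos (∑ j, (Fin.insertNth i θ k : Fin 3 → ℝ) j * ((z - z') j : ℝ)) :=
  fun _ _ _ hq0 hqs hq1 hqev hP0 hPs hGreen i S V u => by
    have h := (green_form_eq_slab_integral hq0 hqs hq1 hqev hP0 hPs hGreen i S V u).2
    simpa only [phase] using h

end Summit.CriticalPhenomena.Ising3DConformalLimit.Cruxes.DirectCorrelationStableTail.SelfEnergyPickInversion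

end
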